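import Summits.QuantumFields.BalabanUV.T4Continuum.Spine.NE1p.TiltedMeanSmoothDual

/-!
# T⁴ programme, spine estimate NE1′ (node O3b/H2) — THE SMOOTH-DUAL CURRENCY ON THE TILT FAMILY: the per-slot influence of a
# fibred (dependent) slot on the TILTED MEAN with constants from `(B, B₁, B₂, |s|)` only, and the letter `a = θ₁²Λ` out of the
# visibility route

Cell `pub-balaban-gaps` (YM blitz Y1, track G2), seat `ne1` gen 6 (prover-pub-balaban-gaps-ne1-g6-0), record `HOME/ne/NE1.md` §4 rows
R42–R43 (gen 6).  ADDITIVE — imports the sibling `TiltedMeanSmoothDual` (same generation: the parent inequality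
`abs_tiltedMean_sub_le_of_tests`, the Taylor majorant `taylor_two_of_deriv_two_bound`, the fibred swap `abs_fibred_swap_le`; through it
gen 5's `TiltedMeanVisibility` — `exp_mul_le_exp_abs`, `exp_neg_abs_le_exp_mul`, `oldInfluenceBudget_of_visibility` — and gen 3's
`OldInfluenceBudget`) ONLY; modifies nothing.

WHAT THIS IS.  The sibling shows that the two derivatives a second-order visibility needs may sit on the TEST FUNCTIONS of the tilt family
instead of on the class law, for an abstract test function with a Taylor majorant.  This file closes the loop on the binder's own object:
* §1 THE TILT FAMILY QUALIFIES: for the loop observable `W` read along the one unit-field line a slot displaces — twice differentiable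
  with `|W| ≤ B`, `|W'| ≤ B₁`, `|W''| ≤ B₂` (a loop is a polynomial in the unit bond variables; these bounds are free) — the two test
  functions `e^{sW}` and `W·e^{sW}` have first-derivative bounds `G₁(s) = |s|B₁e^{|s|B}`, `F₁(s) = (1 + |s|B)B₁e^{|s|B}` and Taylor
  majorants `G₂(s) = (|s|B₂ + s²B₁²)e^{|s|B}`, `F₂(s) = ((1 + |s|B)B₂ + |s|(2 + |s|B)B₁²)e^{|s|B}` (`taylor_two_expTilt`,
  `taylor_two_mulExpTilt`; chain rule + the sibling's mean-value Taylor lemma) — all nondecreasing in `|s|`, so ONE set of constants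
  serves the window `|s| ≤ l₀`: the tilt is as free here as in gen 5's density currency.
* §2 THE FIBRED ATOMIC LAW `fibredLaw EU EV ν κ m ℓ θ = Σ_u Σ_v (ν u·κ u v)·δ_{m u + θ ℓ v}` — the sibling's finite dependent model as a
  measure on `ℝ` (NO density: a finite sum of Dirac masses), its integrals (`integral_fibredLaw`), the swap difference
  (`integral_fibredLaw_sub`), non-degeneracy (`fibredLaw_neZero`).
* §3 **`abs_tiltedMean_fibred_sub_le`** — THE PER-SLOT INFLUENCE ON THE TILTED MEAN, smooth-dual: exterior weights `ν ≥ 0`, fibre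
  kernels `κA` (off) ∕ `κB` (on) depending ARBITRARILY on the exterior with equal fibre masses ([B15] (0.4) fibrewise),
  `|tiltedMean W (on) s − tiltedMean W (off) s| ≤ e^{2|s|B}·(C₁(s)·|θ|·Flat + C₂(s)·θ²·M₂) ∕ mass(on)` with
  `Flat = Σ_u ν_u |Σ_v (κB − κA) ℓ v|` (the FLATNESS channel: fibrewise conditional-mean discrepancy of the slot's linear image — zero at
  conjugation-invariant exteriors, kernel `T4AdInvariant`; NE1.md R28 (2) ∕ R34), `M₂ = Σ_u ν_u Σ_v (κA + κB) ℓ v²` (second moments),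
  `C₁ = (1 + 2|s|B)B₁`, `C₂ = (1 + |s|B)B₂ + |s|(2 + |s|B)B₁² + B(|s|B₂ + s²B₁²)`.  Inputs: the parent inequality, §1, the fibred swap.
  NOT used: any smoothness or absolute continuity of the unit-field law (atomic), any independence of slot and exterior (the kernels are
  arbitrary functions of the exterior), any cluster expansion.  Centred fibres ⇒ pure second order
  (`abs_tiltedMean_fibred_sub_le_of_centred`) = §4's per-slot hypothesis shape with `θ = θ₁^{K − sc X}`.
* §4 **`oldInfluenceBudget_of_displacements`** — THE LETTER `a = θ₁²Λ` OUT OF THE VISIBILITY ROUTE: per-slot bounds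
  `Cv·θ₁^{2(K − sc X)}·M X` (§3 with `Flat = 0` and `θ = θ₁^{K − sc X}`; or gen 5's density currency with `TiltedMeanVisibilityCentred`'s
  second order), second-moment factors `M X ≤ σ`, at most `vol·Λ^{K−j}` scale-`j` slots ⇒ gen 3's `OldInfluenceBudget l₀ T Bad wf sc Δ vol
  (Cv·σ) (θ₁²·Λ)` — the same letter gen 4's squared-amplitude route returns (`TiltedMeanInfluence.oldInfluenceBudget_of_amplitudes`),
  `L⁻² < 1` in `d = 4` (`θ₁ = L⁻³`, `Λ = L⁴`); the power counting gen 5 left «the producer's» is a THEOREM of the displacement model.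
CONSEQUENCE FOR THE ROW (NE1.md v6 §0 l.12, R42–R43).  In the smooth-dual currency the per-slot producer input of the old-component budget is:
the transfer rate `θ₁^{K−j}` of the slot's LINEAR image to the unit field ([B7] (10) ∕ `T4AvgDerivBound`; the nonlinearity of Bałaban's
averaging adds a remainder of the same second order, NOT modelled here), the fibrewise conditional-mean discrepancy `Flat` (zero by
symmetry at flat exteriors; otherwise the flatness channel booked in R28), and second moments — NO smoothness of the class law and NO
decoupling.  Its scope is limited by the sibling's §2∕§4: a SHARP unit-scale class indicator rides with the test function, so this
currency is clean for the full measure, for smooth partitions of unity, and for classes without a unit-scale cut; for Bałaban's sharp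
classes the density currency (gen 5 + sibling §2) is the one that applies.  Classification of NE1′ UNCHANGED: WORK-bound ∕ OBJECT-bound ∕
NOT idea-bound.

HONEST FRAMING.  [folklore] calculus and measure theory (chain rule, mean value inequality, Dirac masses, finite sums) over ABSTRACT data;
the fibred atomic law is a MODEL of one slot (dependent, linearised), NOT Bałaban's class-conditioned law; nothing of his is asserted or
instantiated; which slots have which transfer rate, flatness discrepancy and second moment is row NE1′'s OBJECT-bound content behind
NODE O.  NE1′ NOT proved; spine 0∕9; (B) 0∕13; one fixed finite T⁴ — NOT ℝ⁴, NOT infinite volume, NOT a mass gap, NOT Clay.  0 sorry.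
-/

noncomputable section

open MeasureTheory ProbabilityTheory Finset
open scoped BigOperators NNReal ENNReal

namespace Summit.QuantumFields.BalabanUV.T4Continuum.NE1p.TiltedMeanSmoothDualTilt

open Summit.QuantumFields.BalabanUV.T4Continuum.NE1p.DressedMGFForm (tiltedMean)
open Summit.QuantumFields.BalabanUV.T4Continuum.NE1p.TiltedMeanVisibility (exp_mul_le_exp_abs exp_neg_abs_le_exp_mul
  oldInfluenceBudget_of_visibility)
open Summit.QuantumFields.BalabanUV.T4Continuum.NE1p.TiltedMeanCrossover (OldInfluenceBudget)
open Summit.QuantumFields.BalabanUV.T4Continuum.NE1p.TiltedMeanSmoothDual (abs_tiltedMean_sub_le_of_tests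
  taylor_two_of_deriv_two_bound abs_fibred_swap_le)
open Literature.MathematicalPhysics.QuantumFieldTheory.Balaban1983to89

/-! ## §1 The tilt family qualifies: `e^{sW}` and `W·e^{sW}` along a unit-field line have Taylor majorants from `(B, B₁, B₂, |s|)` -/

section TiltFamily

variable {W W' W'' : ℝ → ℝ} {B B₁ B₂ : ℝ}

/-- `d∕dy e^{sW} = s·W'·e^{sW}`. [folklore] -/
theorem hasDerivAt_expTilt (hW : ∀ y, HasDerivAt W (W' y) y) (s y : ℝ) :
    HasDerivAt (fun y => Real.exp (s * W y)) (s * W' y * Real.exp (s * W y)) y := by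
  refine (((hW y).const_mul s).exp).congr_deriv ?_
  ring

/-- `d²∕dy² e^{sW} = (s·W'' + s²·W'²)·e^{sW}`. [folklore] -/
theorem hasDerivAt_expTilt_deriv (hW : ∀ y, HasDerivAt W (W' y) y) (hW' : ∀ y, HasDerivAt W' (W'' y) y) (s y : ℝ) :
    HasDerivAt (fun y => s * W' y * Real.exp (s * W y))
      ((s * W'' y + s ^ 2 * W' y ^ 2) * Real.exp (s * W y)) y := by
  refine (((hW' y).const_mul s).mul (hasDerivAt_expTilt hW s y)).congr_deriv ?_
  ring

/-- `d∕dy (W·e^{sW}) = (1 + sW)·W'·e^{sW}`. [folklore] -/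
theorem hasDerivAt_mulExpTilt (hW : ∀ y, HasDerivAt W (W' y) y) (s y : ℝ) :
    HasDerivAt (fun y => W y * Real.exp (s * W y)) ((1 + s * W y) * W' y * Real.exp (s * W y)) y := by
  refine ((hW y).mul (hasDerivAt_expTilt hW s y)).congr_deriv ?_
  ring

/-- `d²∕dy² (W·e^{sW}) = ((1 + sW)·W'' + s·(2 + sW)·W'²)·e^{sW}`. [folklore] -/
theorem hasDerivAt_mulExpTilt_deriv (hW : ∀ y, HasDerivAt W (W' y) y) (hW' : ∀ y, HasDerivAt W' (W'' y) y)
    (s y : ℝ) :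
    HasDerivAt (fun y => (1 + s * W y) * W' y * Real.exp (s * W y))
      (((1 + s * W y) * W'' y + s * (2 + s * W y) * W' y ^ 2) * Real.exp (s * W y)) y := by
  have h1 : HasDerivAt (fun y => 1 + s * W y) (s * W' y) y := by
    simpa using ((hW y).const_mul s).const_add 1
  refine ((h1.mul (hW' y)).mul (hasDerivAt_expTilt hW s y)).congr_deriv ?_
  simp only [Pi.mul_apply]
  ring

/-- The first derivative of `e^{sW}` is at most `G₁(s) = |s|·B₁·e^{|s|B}`. [folklore] -/
theorem abs_expTilt_deriv_le (hWb : ∀ y, |W y| ≤ B) (hW'b : ∀ y, |W' y| ≤ B₁) (s y : ℝ) :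
    |s * W' y * Real.exp (s * W y)| ≤ |s| * B₁ * Real.exp (|s| * B) := by
  rw [abs_mul, abs_mul, abs_of_pos (Real.exp_pos _)]
  have h1 : |s| * |W' y| ≤ |s| * B₁ := mul_le_mul_of_nonneg_left (hW'b y) (abs_nonneg s)
  exact mul_le_mul h1 (exp_mul_le_exp_abs hWb s y) (Real.exp_pos _).le
    ((mul_nonneg (abs_nonneg _) (abs_nonneg _)).trans h1)

/-- The second derivative of `e^{sW}` is at most `G₂(s) = (|s|·B₂ + s²·B₁²)·e^{|s|B}`. [folklore] -/
theorem abs_expTilt_deriv_two_le (hWb : ∀ y, |W y| ≤ B) (hW'b : ∀ y, |W' y| ≤ B₁) (hW''b : ∀ y, |W'' y| ≤ B₂)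
    (s y : ℝ) :
    |(s * W'' y + s ^ 2 * W' y ^ 2) * Real.exp (s * W y)| ≤ (|s| * B₂ + s ^ 2 * B₁ ^ 2) * Real.exp (|s| * B) := by
  rw [abs_mul, abs_of_pos (Real.exp_pos _)]
  have h1 : |s * W'' y + s ^ 2 * W' y ^ 2| ≤ |s| * B₂ + s ^ 2 * B₁ ^ 2 := by
    have e1 : |s * W'' y| ≤ |s| * B₂ := by
      rw [abs_mul]; exact mul_le_mul_of_nonneg_left (hW''b y) (abs_nonneg s)
    have e2 : |s ^ 2 * W' y ^ 2| ≤ s ^ 2 * B₁ ^ 2 := by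
      rw [abs_of_nonneg (mul_nonneg (sq_nonneg s) (sq_nonneg (W' y)))]
      exact mul_le_mul_of_nonneg_left ((by rw [← sq_abs (W' y)]; exact pow_le_pow_left₀ (abs_nonneg _) (hW'b y) 2)) (sq_nonneg s)
    exact (abs_add_le _ _).trans (add_le_add e1 e2)
  exact mul_le_mul h1 (exp_mul_le_exp_abs hWb s y) (Real.exp_pos _).le ((abs_nonneg _).trans h1)

/-- The first derivative of `W·e^{sW}` is at most `F₁(s) = (1 + |s|B)·B₁·e^{|s|B}`. [folklore] -/
theorem abs_mulExpTilt_deriv_le (hWb : ∀ y, |W y| ≤ B) (hW'b : ∀ y, |W' y| ≤ B₁) (s y : ℝ) :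
    |(1 + s * W y) * W' y * Real.exp (s * W y)| ≤ (1 + |s| * B) * B₁ * Real.exp (|s| * B) := by
  rw [abs_mul, abs_mul, abs_of_pos (Real.exp_pos _)]
  have h0 : |1 + s * W y| ≤ 1 + |s| * B := by
    calc |1 + s * W y| ≤ |(1 : ℝ)| + |s * W y| := abs_add_le _ _
      _ = 1 + |s| * |W y| := by rw [abs_one, abs_mul]
      _ ≤ 1 + |s| * B := by gcongr; exact hWb y
  have h1 : |1 + s * W y| * |W' y| ≤ (1 + |s| * B) * B₁ :=
    mul_le_mul h0 (hW'b y) (abs_nonneg _) ((abs_nonneg _).trans h0)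
  exact mul_le_mul h1 (exp_mul_le_exp_abs hWb s y) (Real.exp_pos _).le
    ((mul_nonneg (abs_nonneg _) (abs_nonneg _)).trans h1)

/-- The second derivative of `W·e^{sW}` is at most `F₂(s) = ((1 + |s|B)·B₂ + |s|·(2 + |s|B)·B₁²)·e^{|s|B}`. [folklore] -/
theorem abs_mulExpTilt_deriv_two_le (hWb : ∀ y, |W y| ≤ B) (hW'b : ∀ y, |W' y| ≤ B₁) (hW''b : ∀ y, |W'' y| ≤ B₂)
    (s y : ℝ) :
    |((1 + s * W y) * W'' y + s * (2 + s * W y) * W' y ^ 2) * Real.exp (s * W y)|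
      ≤ ((1 + |s| * B) * B₂ + |s| * (2 + |s| * B) * B₁ ^ 2) * Real.exp (|s| * B) := by
  rw [abs_mul, abs_of_pos (Real.exp_pos _)]
  have h0 : |1 + s * W y| ≤ 1 + |s| * B := by
    calc |1 + s * W y| ≤ |(1 : ℝ)| + |s * W y| := abs_add_le _ _
      _ = 1 + |s| * |W y| := by rw [abs_one, abs_mul]
      _ ≤ 1 + |s| * B := by gcongr; exact hWb y
  have h0' : |2 + s * W y| ≤ 2 + |s| * B := by
    calc |2 + s * W y| ≤ |(2 : ℝ)| + |s * W y| := abs_add_le _ _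
      _ = 2 + |s| * |W y| := by rw [abs_two, abs_mul]
      _ ≤ 2 + |s| * B := by gcongr; exact hWb y
  have h1 : |(1 + s * W y) * W'' y + s * (2 + s * W y) * W' y ^ 2|
      ≤ (1 + |s| * B) * B₂ + |s| * (2 + |s| * B) * B₁ ^ 2 := by
    have e1 : |(1 + s * W y) * W'' y| ≤ (1 + |s| * B) * B₂ := by
      rw [abs_mul]; exact mul_le_mul h0 (hW''b y) (abs_nonneg _) ((abs_nonneg _).trans h0)
    have e2 : |s * (2 + s * W y) * W' y ^ 2| ≤ |s| * (2 + |s| * B) * B₁ ^ 2 := by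
      rw [abs_mul, abs_mul, abs_of_nonneg (sq_nonneg (W' y))]
      exact mul_le_mul (mul_le_mul_of_nonneg_left h0' (abs_nonneg s)) ((by rw [← sq_abs (W' y)]; exact pow_le_pow_left₀ (abs_nonneg _) (hW'b y) 2)) (sq_nonneg _)
        (mul_nonneg (abs_nonneg s) ((abs_nonneg _).trans h0'))
    exact (abs_add_le _ _).trans (add_le_add e1 e2)
  exact mul_le_mul h1 (exp_mul_le_exp_abs hWb s y) (Real.exp_pos _).le ((abs_nonneg _).trans h1)

/-- **`e^{sW}` HAS THE TAYLOR MAJORANT `G₂(s)`**: `|e^{sW(x+h)} − e^{sW(x)} − h·(e^{sW})'(x)| ≤ (|s|B₂ + s²B₁²)·e^{|s|B}·h²` for a twice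
differentiable `W` with `|W| ≤ B`, `|W'| ≤ B₁`, `|W''| ≤ B₂` (the loop observable read along the one unit-field line a slot displaces:
a loop is a polynomial in the unit bond variables, so these bounds are free). [folklore] -/
theorem taylor_two_expTilt (hW : ∀ y, HasDerivAt W (W' y) y) (hW' : ∀ y, HasDerivAt W' (W'' y) y)
    (hWb : ∀ y, |W y| ≤ B) (hW'b : ∀ y, |W' y| ≤ B₁) (hW''b : ∀ y, |W'' y| ≤ B₂) (s x h : ℝ) :
    |Real.exp (s * W (x + h)) - Real.exp (s * W x) - h * (s * W' x * Real.exp (s * W x))|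
      ≤ (|s| * B₂ + s ^ 2 * B₁ ^ 2) * Real.exp (|s| * B) * h ^ 2 :=
  taylor_two_of_deriv_two_bound (hasDerivAt_expTilt hW s) (hasDerivAt_expTilt_deriv hW hW' s)
    (abs_expTilt_deriv_two_le hWb hW'b hW''b s) x h

/-- **`W·e^{sW}` HAS THE TAYLOR MAJORANT `F₂(s)`.** [folklore] -/
theorem taylor_two_mulExpTilt (hW : ∀ y, HasDerivAt W (W' y) y) (hW' : ∀ y, HasDerivAt W' (W'' y) y)
    (hWb : ∀ y, |W y| ≤ B) (hW'b : ∀ y, |W' y| ≤ B₁) (hW''b : ∀ y, |W'' y| ≤ B₂) (s x h : ℝ) :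
    |W (x + h) * Real.exp (s * W (x + h)) - W x * Real.exp (s * W x)
        - h * ((1 + s * W x) * W' x * Real.exp (s * W x))|
      ≤ ((1 + |s| * B) * B₂ + |s| * (2 + |s| * B) * B₁ ^ 2) * Real.exp (|s| * B) * h ^ 2 :=
  taylor_two_of_deriv_two_bound (hasDerivAt_mulExpTilt hW s) (hasDerivAt_mulExpTilt_deriv hW hW' s)
    (abs_mulExpTilt_deriv_two_le hWb hW'b hW''b s) x h

end TiltFamily

/-! ## §2 The fibred atomic law of one slot on the unit-field line, and its integrals -/

section Fibred

variable {U V : Type*}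

/-- The FIBRED ATOMIC LAW of the unit-field coordinate: exterior `u ∈ EU` with weight `ν u`, slot value `v ∈ EV` with fibre weight
`κ u v`, unit-field value `m u + θ·ℓ v` — the finite model of `TiltedMeanSmoothDual` §3 as a measure on `ℝ` (a finite sum of weighted
Dirac masses; NO density). -/
def fibredLaw (EU : Finset U) (EV : Finset V) (ν : U → ℝ) (κ : U → V → ℝ) (m : U → ℝ) (ℓ : V → ℝ) (θ : ℝ) :
    Measure ℝ :=
  ∑ u ∈ EU, ∑ v ∈ EV, ENNReal.ofReal (ν u * κ u v) • Measure.dirac (m u + θ * ℓ v)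

variable {EU : Finset U} {EV : Finset V} {ν : U → ℝ} {κ κA κB : U → V → ℝ} {m : U → ℝ} {ℓ : V → ℝ} {θ : ℝ}

/-- The fibred atomic law is a finite measure (a finite sum of finite multiples of Dirac masses). [folklore] -/
instance isFiniteMeasure_fibredLaw : IsFiniteMeasure (fibredLaw EU EV ν κ m ℓ θ) := by
  refine ⟨?_⟩
  simp only [fibredLaw, Measure.coe_finsetSum, Measure.coe_smul, Finset.sum_apply, Pi.smul_apply, measure_univ,
    smul_eq_mul, mul_one]
  exact ENNReal.sum_lt_top.mpr fun u _ => ENNReal.sum_lt_top.mpr fun v _ => ENNReal.ofReal_lt_top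

/-- Integrals against the fibred atomic law are the fibred finite sums (every `g : ℝ → ℝ`). [folklore] -/
theorem integral_fibredLaw (g : ℝ → ℝ) (hν : ∀ u ∈ EU, 0 ≤ ν u) (hκ : ∀ u ∈ EU, ∀ v ∈ EV, 0 ≤ κ u v) :
    ∫ x, g x ∂(fibredLaw EU EV ν κ m ℓ θ) = ∑ u ∈ EU, ν u * ∑ v ∈ EV, κ u v * g (m u + θ * ℓ v) := by
  have hi : ∀ a : ℝ, Integrable g (Measure.dirac a) := fun a => (integrable_const (g a)).congr (ae_eq_dirac g).symm
  have hiv : ∀ u, ∀ v ∈ EV, Integrable g (ENNReal.ofReal (ν u * κ u v) • Measure.dirac (m u + θ * ℓ v)) :=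
    fun u v _ => (hi _).smul_measure ENNReal.ofReal_ne_top
  unfold fibredLaw
  rw [integral_finsetSum_measure fun u _ => integrable_finsetSum_measure.mpr (hiv u)]
  refine sum_congr rfl fun u hu => ?_
  rw [integral_finsetSum_measure (hiv u), mul_sum]
  refine sum_congr rfl fun v hv => ?_
  rw [integral_smul_measure, integral_dirac, ENNReal.toReal_ofReal (mul_nonneg (hν u hu) (hκ u hu v hv)), smul_eq_mul,
    mul_assoc]

/-- The difference of the two fibred laws' integrals is the fibred swap sum of `TiltedMeanSmoothDual.abs_fibred_swap_le`. [folklore] -/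
theorem integral_fibredLaw_sub (g : ℝ → ℝ) (hν : ∀ u ∈ EU, 0 ≤ ν u) (hκA : ∀ u ∈ EU, ∀ v ∈ EV, 0 ≤ κA u v)
    (hκB : ∀ u ∈ EU, ∀ v ∈ EV, 0 ≤ κB u v) :
    (∫ x, g x ∂(fibredLaw EU EV ν κB m ℓ θ)) - ∫ x, g x ∂(fibredLaw EU EV ν κA m ℓ θ)
      = ∑ u ∈ EU, ν u * ∑ v ∈ EV, (κB u v - κA u v) * g (m u + θ * ℓ v) := by
  rw [integral_fibredLaw g hν hκB, integral_fibredLaw g hν hκA, ← sum_sub_distrib]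
  refine sum_congr rfl fun u _ => ?_
  rw [← mul_sub, ← sum_sub_distrib]
  congr 1
  refine sum_congr rfl fun v _ => ?_
  ring

/-- A fibred law of positive total weight is non-zero. [folklore] -/
theorem fibredLaw_neZero (hν : ∀ u ∈ EU, 0 ≤ ν u) (hκ : ∀ u ∈ EU, ∀ v ∈ EV, 0 ≤ κ u v)
    (hpos : 0 < ∑ u ∈ EU, ν u * ∑ v ∈ EV, κ u v) : NeZero (fibredLaw EU EV ν κ m ℓ θ) := by
  refine ⟨fun h0 => ?_⟩
  have h1 := integral_fibredLaw (EU := EU) (EV := EV) (ν := ν) (κ := κ) (m := m) (ℓ := ℓ) (θ := θ) (fun _ => (1 : ℝ)) hν hκ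
  rw [h0, integral_zero_measure] at h1
  simp only [mul_one] at h1
  exact (lt_irrefl (0 : ℝ)) (h1 ▸ hpos)

end Fibred

/-! ## §3 The per-slot influence on the TILTED MEAN in the smooth-dual currency: constants from `(B, B₁, B₂, |s|)` only -/

section Influence

variable {U V : Type*} {EU : Finset U} {EV : Finset V} {ν : U → ℝ} {κA κB : U → V → ℝ} {m : U → ℝ} {ℓ : V → ℝ}
  {θ : ℝ} {W W' W'' : ℝ → ℝ} {B B₁ B₂ : ℝ}

/-- **THE PER-SLOT INFLUENCE OF A FIBRED SLOT ON THE TILTED MEAN — SMOOTH-DUAL, DEPENDENT, LAW-SMOOTHNESS-FREE.**  Exterior weights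
`ν ≥ 0`, fibre kernels `κA` (off), `κB` (on) `≥ 0` depending arbitrarily on the exterior with equal fibre masses and positive total
weight on, unit field `m u + θ·ℓ v`, loop observable `W` along the line twice differentiable with `|W| ≤ B`, `|W'| ≤ B₁`,
`|W''| ≤ B₂`.  Then for EVERY tilt `s`, with `Flat = Σ_u ν_u·|Σ_v (κB − κA)(u,v)·ℓ v|` (fibrewise conditional-mean discrepancy of the
slot's linear image — the flatness channel) and `M₂ = Σ_u ν_u Σ_v (κA + κB)(u,v)·(ℓ v)²` (second moments):
`|tiltedMean W (on) s − tiltedMean W (off) s| ≤ e^{2|s|B}·(C₁(s)·|θ|·Flat + C₂(s)·θ²·M₂) ∕ Σ_u ν_u Σ_v κB(u,v)`,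
`C₁(s) = (1 + 2|s|B)·B₁`, `C₂(s) = (1 + |s|B)·B₂ + |s|(2 + |s|B)·B₁² + B·(|s|B₂ + s²B₁²)` — nondecreasing in `|s|`, so ONE pair of
constants serves the whole window `|s| ≤ l₀`.  Inputs used: the parent inequality (`TiltedMeanSmoothDual` §1), Taylor on the two test
functions `W e^{sW}`, `e^{sW}` (§1 here), the fibred swap (`TiltedMeanSmoothDual` §3).  NOT used: any smoothness or absolute continuity
of the unit-field law (it is atomic), any independence of slot and exterior, any expansion. [folklore] -/
theorem abs_tiltedMean_fibred_sub_le (hν : ∀ u ∈ EU, 0 ≤ ν u) (hκA : ∀ u ∈ EU, ∀ v ∈ EV, 0 ≤ κA u v)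
    (hκB : ∀ u ∈ EU, ∀ v ∈ EV, 0 ≤ κB u v) (hmass : ∀ u ∈ EU, ∑ v ∈ EV, κA u v = ∑ v ∈ EV, κB u v)
    (hpos : 0 < ∑ u ∈ EU, ν u * ∑ v ∈ EV, κB u v)
    (hWm : Measurable W) (hW : ∀ y, HasDerivAt W (W' y) y) (hW' : ∀ y, HasDerivAt W' (W'' y) y)
    (hWb : ∀ y, |W y| ≤ B) (hW'b : ∀ y, |W' y| ≤ B₁) (hW''b : ∀ y, |W'' y| ≤ B₂) (s : ℝ) :
    |tiltedMean W (fibredLaw EU EV ν κB m ℓ θ) s - tiltedMean W (fibredLaw EU EV ν κA m ℓ θ) s|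
      ≤ Real.exp (2 * (|s| * B)) *
          ((1 + 2 * |s| * B) * B₁ * |θ| * (∑ u ∈ EU, ν u * |∑ v ∈ EV, (κB u v - κA u v) * ℓ v|)
            + ((1 + |s| * B) * B₂ + |s| * (2 + |s| * B) * B₁ ^ 2 + B * (|s| * B₂ + s ^ 2 * B₁ ^ 2)) * θ ^ 2
              * (∑ u ∈ EU, ν u * ∑ v ∈ EV, (κA u v + κB u v) * ℓ v ^ 2))
        / (∑ u ∈ EU, ν u * ∑ v ∈ EV, κB u v) := by
  haveI := fibredLaw_neZero (m := m) (ℓ := ℓ) (θ := θ) hν hκB hpos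
  have hB : 0 ≤ B := (abs_nonneg _).trans (hWb 0)
  -- the two test integrals, by the fibred swap with Taylor on the test functions (§1 + `TiltedMeanSmoothDual` §3)
  have hD₁ : |(∫ x, W x * Real.exp (s * W x) ∂(fibredLaw EU EV ν κB m ℓ θ))
      - ∫ x, W x * Real.exp (s * W x) ∂(fibredLaw EU EV ν κA m ℓ θ)|
      ≤ (1 + |s| * B) * B₁ * Real.exp (|s| * B) * |θ| * (∑ u ∈ EU, ν u * |∑ v ∈ EV, (κB u v - κA u v) * ℓ v|)
        + ((1 + |s| * B) * B₂ + |s| * (2 + |s| * B) * B₁ ^ 2) * Real.exp (|s| * B) * θ ^ 2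
          * (∑ u ∈ EU, ν u * ∑ v ∈ EV, (κA u v + κB u v) * ℓ v ^ 2) := by
    rw [integral_fibredLaw_sub (fun x => W x * Real.exp (s * W x)) hν hκA hκB]
    exact abs_fibred_swap_le (g := fun x => W x * Real.exp (s * W x))
      (g' := fun x => (1 + s * W x) * W' x * Real.exp (s * W x)) hν hκA hκB hmass
      (taylor_two_mulExpTilt hW hW' hWb hW'b hW''b s) (abs_mulExpTilt_deriv_le hWb hW'b s)
  have hD₀ : |(∫ x, Real.exp (s * W x) ∂(fibredLaw EU EV ν κB m ℓ θ))
      - ∫ x, Real.exp (s * W x) ∂(fibredLaw EU EV ν κA m ℓ θ)|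
      ≤ |s| * B₁ * Real.exp (|s| * B) * |θ| * (∑ u ∈ EU, ν u * |∑ v ∈ EV, (κB u v - κA u v) * ℓ v|)
        + (|s| * B₂ + s ^ 2 * B₁ ^ 2) * Real.exp (|s| * B) * θ ^ 2
          * (∑ u ∈ EU, ν u * ∑ v ∈ EV, (κA u v + κB u v) * ℓ v ^ 2) := by
    rw [integral_fibredLaw_sub (fun x => Real.exp (s * W x)) hν hκA hκB]
    exact abs_fibred_swap_le (g := fun x => Real.exp (s * W x)) (g' := fun x => s * W' x * Real.exp (s * W x))
      hν hκA hκB hmass (taylor_two_expTilt hW hW' hWb hW'b hW''b s) (abs_expTilt_deriv_le hWb hW'b s)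
  -- the parent inequality (`TiltedMeanSmoothDual` §1)
  have hpar := abs_tiltedMean_sub_le_of_tests (π := fibredLaw EU EV ν κA m ℓ θ) (π' := fibredLaw EU EV ν κB m ℓ θ)
    hWm hWb s hD₁ hD₀
  -- the denominator: `∫ e^{sW} d(on) ≥ e^{−|s|B}·mass`
  have hZ : Real.exp (-(|s| * B)) * (∑ u ∈ EU, ν u * ∑ v ∈ EV, κB u v)
      ≤ ∫ x, Real.exp (s * W x) ∂(fibredLaw EU EV ν κB m ℓ θ) := by
    rw [integral_fibredLaw (fun x => Real.exp (s * W x)) hν hκB, mul_sum]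
    refine sum_le_sum fun u hu => ?_
    rw [mul_left_comm, mul_sum]
    refine mul_le_mul_of_nonneg_left (sum_le_sum fun v hv => ?_) (hν u hu)
    rw [mul_comm (Real.exp (-(|s| * B))) (κB u v)]
    exact mul_le_mul_of_nonneg_left (exp_neg_abs_le_exp_mul hWb s (m u + θ * ℓ v)) (hκB u hu v hv)
  -- names, and the assembly
  set Flat := ∑ u ∈ EU, ν u * |∑ v ∈ EV, (κB u v - κA u v) * ℓ v| with hFlat
  set M₂ := ∑ u ∈ EU, ν u * ∑ v ∈ EV, (κA u v + κB u v) * ℓ v ^ 2 with hM₂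
  set mass := ∑ u ∈ EU, ν u * ∑ v ∈ EV, κB u v with hmassB
  set eB := Real.exp (|s| * B) with heB
  set eB' := Real.exp (-(|s| * B)) with heB'
  have hmass0 : 0 < mass := hpos
  have hZpos : 0 < eB' * mass := mul_pos (Real.exp_pos _) hmass0
  have hnum0 : 0 ≤ (1 + |s| * B) * B₁ * eB * |θ| * Flat
        + ((1 + |s| * B) * B₂ + |s| * (2 + |s| * B) * B₁ ^ 2) * eB * θ ^ 2 * M₂
      + B * (|s| * B₁ * eB * |θ| * Flat + (|s| * B₂ + s ^ 2 * B₁ ^ 2) * eB * θ ^ 2 * M₂) :=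
    add_nonneg ((abs_nonneg _).trans hD₁) (mul_nonneg hB ((abs_nonneg _).trans hD₀))
  have he : Real.exp (2 * (|s| * B)) * eB' = eB := by
    rw [heB, heB', ← Real.exp_add]; congr 1; ring
  calc |tiltedMean W (fibredLaw EU EV ν κB m ℓ θ) s - tiltedMean W (fibredLaw EU EV ν κA m ℓ θ) s|
      ≤ ((1 + |s| * B) * B₁ * eB * |θ| * Flat
            + ((1 + |s| * B) * B₂ + |s| * (2 + |s| * B) * B₁ ^ 2) * eB * θ ^ 2 * M₂
          + B * (|s| * B₁ * eB * |θ| * Flat + (|s| * B₂ + s ^ 2 * B₁ ^ 2) * eB * θ ^ 2 * M₂))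
          / (eB' * mass) :=
        hpar.trans (div_le_div_of_nonneg_left hnum0 hZpos hZ)
    _ = Real.exp (2 * (|s| * B)) *
          ((1 + 2 * |s| * B) * B₁ * |θ| * Flat
            + ((1 + |s| * B) * B₂ + |s| * (2 + |s| * B) * B₁ ^ 2 + B * (|s| * B₂ + s ^ 2 * B₁ ^ 2)) * θ ^ 2 * M₂)
          / mass := by
        rw [div_eq_div_iff (ne_of_gt hZpos) (ne_of_gt hmass0), ← he]
        ring

/-- **CENTRED FIBRES ⇒ PURE SECOND ORDER ON THE TILTED MEAN.**  If in addition the slot's linear image has equal fibrewise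
conditional means off and on (`Σ_v κA u v·ℓ v = Σ_v κB u v·ℓ v` for every exterior `u` — conjugation symmetry at a flat exterior),
the flatness channel vanishes and `|tiltedMean W (on) s − tiltedMean W (off) s| ≤ e^{2|s|B}·C₂(s)·θ²·M₂ ∕ mass(on)`: with
`θ = θ₁^{K − sc X}` this is the per-slot hypothesis `|Δ| ≤ Cv·θ₁^{2(K − sc X)}·M X` of §4 (`Cv = e^{2l₀B}·C₂(l₀)` on the window,
`M X = M₂ ∕ mass`). [folklore] -/
theorem abs_tiltedMean_fibred_sub_le_of_centred (hν : ∀ u ∈ EU, 0 ≤ ν u) (hκA : ∀ u ∈ EU, ∀ v ∈ EV, 0 ≤ κA u v)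
    (hκB : ∀ u ∈ EU, ∀ v ∈ EV, 0 ≤ κB u v) (hmass : ∀ u ∈ EU, ∑ v ∈ EV, κA u v = ∑ v ∈ EV, κB u v)
    (hmean : ∀ u ∈ EU, ∑ v ∈ EV, κA u v * ℓ v = ∑ v ∈ EV, κB u v * ℓ v)
    (hpos : 0 < ∑ u ∈ EU, ν u * ∑ v ∈ EV, κB u v)
    (hWm : Measurable W) (hW : ∀ y, HasDerivAt W (W' y) y) (hW' : ∀ y, HasDerivAt W' (W'' y) y)
    (hWb : ∀ y, |W y| ≤ B) (hW'b : ∀ y, |W' y| ≤ B₁) (hW''b : ∀ y, |W'' y| ≤ B₂) (s : ℝ) :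
    |tiltedMean W (fibredLaw EU EV ν κB m ℓ θ) s - tiltedMean W (fibredLaw EU EV ν κA m ℓ θ) s|
      ≤ Real.exp (2 * (|s| * B)) *
          (((1 + |s| * B) * B₂ + |s| * (2 + |s| * B) * B₁ ^ 2 + B * (|s| * B₂ + s ^ 2 * B₁ ^ 2)) * θ ^ 2
            * (∑ u ∈ EU, ν u * ∑ v ∈ EV, (κA u v + κB u v) * ℓ v ^ 2))
        / (∑ u ∈ EU, ν u * ∑ v ∈ EV, κB u v) := by
  have h := abs_tiltedMean_fibred_sub_le (m := m) (ℓ := ℓ) (θ := θ) hν hκA hκB hmass hpos hWm hW hW' hWb hW'b hW''b s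
  have h0 : ∑ u ∈ EU, ν u * |∑ v ∈ EV, (κB u v - κA u v) * ℓ v| = 0 := by
    refine sum_eq_zero fun u hu => ?_
    have : ∑ v ∈ EV, (κB u v - κA u v) * ℓ v = 0 := by
      simp only [sub_mul, sum_sub_distrib, hmean u hu, sub_self]
    rw [this, abs_zero, mul_zero]
  rw [h0, mul_zero, zero_add] at h
  exact h

end Influence

/-! ## §4 The ledger level: displacement visibilities `θ₁^{2(K−j)}` against counts `Λ^{K−j}` give `OldInfluenceBudget` with ratio `θ₁²Λ` -/

section Ledger

variable {ι D : Type*} [DecidableEq ι] {l₀ vol : ℝ} {T : ℕ → Finset ι} {Bad : ℕ → ℝ → Finset ι}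
  {wf : ℕ → ι → Finset D} {sc : ℕ → D → ℕ} {Δ : ℕ → ℝ → ι → ℝ → D → ℝ}

/-- **THE LETTER `a = θ₁²Λ` OUT OF THE VISIBILITY ROUTE.**  If on every good class and every tilt `|s| ≤ l₀` each slot's influence
is at most `Cv·θ₁^{2(K − sc X)}·M X` (§1 + §3: `Cv` = the tilt family's constant on the window, `θ₁^{K−j}` = the transfer rate of a
scale-`j` slot to the unit lattice, `M X ≤ σ` its second-moment factor), and there are at most `vol·Λ^{K−j}` scale-`j` slots,
then gen 3's one-run budget holds with ratio `θ₁²·Λ`: `OldInfluenceBudget l₀ T Bad wf sc Δ vol (Cv·σ) (θ₁²·Λ)` — the same letter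
gen 4's squared-amplitude route returns (`TiltedMeanInfluence.oldInfluenceBudget_of_amplitudes`); `L⁻² < 1` in `d = 4`
(`θ₁ = L⁻³`, `Λ = L⁴`).  The power counting is thereby a THEOREM of the displacement model; which slots of Bałaban's run have
which transfer rate and second moment is NODE O's object. [folklore] -/
theorem oldInfluenceBudget_of_displacements {M : ℕ → ι → D → ℝ} {Cv σ θ₁ Λ : ℝ} (hCv : 0 ≤ Cv) (hθ₁ : 0 ≤ θ₁)
    (hσ : 0 ≤ σ)
    (hΔ : ∀ K (t : ℝ), |t| ≤ l₀ → ∀ τ ∈ T K \ Bad K t, ∀ s : ℝ, |s| ≤ l₀ →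
      ∀ X ∈ wf K τ, |Δ K t τ s X| ≤ Cv * (θ₁ ^ (2 * (K - sc K X)) * M K τ X))
    (hM : ∀ K (τ : ι), ∀ X ∈ wf K τ, M K τ X ≤ σ)
    (hcount : ∀ K (τ : ι), ∀ j ≤ K, (((wf K τ).filter fun X => sc K X = j).card : ℝ) ≤ vol * Λ ^ (K - j)) :
    OldInfluenceBudget l₀ T Bad wf sc Δ vol (Cv * σ) (θ₁ ^ 2 * Λ) := by
  refine oldInfluenceBudget_of_visibility (vis := fun K τ X => θ₁ ^ (2 * (K - sc K X)) * M K τ X) hCv hΔ ?_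
  intro K τ j hj
  have hq : 0 ≤ θ₁ ^ (2 * (K - j)) * σ := mul_nonneg (pow_nonneg hθ₁ _) hσ
  calc ∑ X ∈ wf K τ with sc K X = j, θ₁ ^ (2 * (K - sc K X)) * M K τ X
      ≤ ∑ X ∈ wf K τ with sc K X = j, θ₁ ^ (2 * (K - j)) * σ := by
        refine sum_le_sum fun X hX => ?_
        obtain ⟨hXw, hXj⟩ := mem_filter.mp hX
        rw [hXj]
        exact mul_le_mul_of_nonneg_left (hM K τ X hXw) (pow_nonneg hθ₁ _)
    _ = (((wf K τ).filter fun X => sc K X = j).card : ℝ) * (θ₁ ^ (2 * (K - j)) * σ) := by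
        rw [sum_const, nsmul_eq_mul]
    _ ≤ (vol * Λ ^ (K - j)) * (θ₁ ^ (2 * (K - j)) * σ) := mul_le_mul_of_nonneg_right (hcount K τ j hj) hq
    _ = vol * (σ * (θ₁ ^ 2 * Λ) ^ (K - j)) := by rw [mul_pow, ← pow_mul]; ring

end Ledger

end Summit.QuantumFields.BalabanUV.T4Continuum.NE1p.TiltedMeanSmoothDualTilt

end
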